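/-
Copyright (c) 2026. All rights reserved.
Released under Apache 2.0 license as described in the file LICENSE.
-/
import Summits.NavierStokesRegularity.FluidComputer.RowCircuitSectionU
import Summits.NavierStokesRegularity.FluidComputer.RowCircuitMachine
import HarnessLib

/-!
# The toy machine under class-U forcing: every window perturbed, still infinitely many windows in finite time

HONEST FRAMING (cell `pub-fluidc`, blueprint seat bp3, gen 23): low prior, high value-of-information
experiment on Tao's machine paradigm; NOT a claim that NS blows up. Everything here concerns the
9-mode TOY chain `F gK ΛK` (R1-DESIGN §7–§12); nothing is claimed about Navier–Stokes.

`RowCircuitMachine` iterates the EXACT induction step. Here the environment may, in addition to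
choosing the quiet fresh modes `qm n` (interface axiom (Q)), FORCE every window: in window `n`'s own
(renormalised) units by an arbitrary continuous `δF n` of CLASS U, `|δF n σ a| ≤ δUQ a`
(`2⁻¹⁹` on `a₁..d₁`, `2⁻²⁹` on `a₂..e₂`; interface axiom (U) — "everything the true coupling adds
to the window"). By `robust_induction_step_of` a forced solution exists from every state of `reBox`
and EVERY forced solution reaches the section with certified level and re-entering read-outs, so
the same recursion runs: `MachineDataU.machine`. In physical units window `n` solves
`ẇ = ΛKⁿ•F(w) + Φₙ` with `Φₙ(t) = (amp n)²·ΛKⁿ • δF n (amp n·ΛKⁿ·t)` (`win_solves`; the model's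
scaling symmetry extended to forced solutions, `forced_solution_scale`) — i.e. the admissible
perturbation of window `n` is class U RELATIVE to the window's own nonlinearity scale
`(amp n)²·ΛKⁿ`. Clock bound `clock N ≤ 1.2/A₀` and growth `ΛKⁿ·amp n ≥ A₀·5ⁿ` as in the exact case.
COMPUTATIONAL (transitively `Lean.ofReduceBool` through the chain cone). No `sorry`, no new axioms.
-/

namespace Summit.NavierStokesRegularity.FluidComputer

open Literature.Analysis.FluidPDE.FluidComputer

namespace ChainField

variable {g : GateData} {Λ : ℝ}

/-- **Scaling of FORCED solutions**: if `ẏ = F(y) + δF` then `t ↦ A·y(Aκt)` solves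
`ẇ = κ•F(w) + (A²κ)•δF(Aκt)`. [folklore] -/
theorem forced_solution_scale {y δF : ℝ → Fin 9 → ℝ}
    (hsol : ∀ σ, HasDerivAt y (F g Λ (y σ) + δF σ) σ) (A κ : ℝ) :
    ∀ t, HasDerivAt (fun s => A • y (A * (κ * s)))
      (κ • F g Λ (A • y (A * (κ * t))) + (A ^ 2 * κ) • δF (A * (κ * t))) t := by
  intro t
  have h1 : HasDerivAt (fun s => y (A * (κ * s)))
      ((A * κ) • (F g Λ (y (A * (κ * t))) + δF (A * (κ * t)))) t := by
    have h := (hsol (A * (κ * t))).scomp t (((hasDerivAt_id t).const_mul κ).const_mul A)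
    simp only [mul_one] at h
    exact h
  have h2 := h1.const_smul A
  have hs : A * (A * κ) = A ^ 2 * κ := by ring
  rw [smul_smul, hs, smul_add] at h2
  rw [F_smul, smul_smul, show κ * A ^ 2 = A ^ 2 * κ by ring]
  exact h2

end ChainField

namespace RowChain

open RowCheck RowCheck.RowData RowRun ChainField Finset

/-- **Forced machine data**: the re-entry certificate, a quiet fresh-mode environment, a class-U
forcing environment (one continuous forcing per window, in that window's units), a start state and
a physical amplitude. [folklore] -/
structure MachineDataU where
  hre : reentryOK (row 0) reBox = true
  qm : ℕ → Fin 4 → ℝ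
  hqm : ∀ n m, |qm n m - (Q1C m : ℝ)| ≤ Q1W m
  /-- the forcing of window `n`, in window `n`'s renormalised units -/
  δF : ℕ → ℝ → Fin 9 → ℝ
  hδc : ∀ n, Continuous (δF n)
  /-- interface axiom (U): class U -/
  hδ : ∀ n σ a, |δF n σ a| ≤ (δUQ a : ℝ)
  s₀ : ReState
  A₀ : ℝ
  hA₀ : 0 < A₀

/-- The forced induction step at level `n`, packed for `Classical.choose`: SOME forced solution from
`s` (existence) with ITS section data (valid for every forced solution). [folklore] -/
theorem step_specU (D : MachineDataU) (n : ℕ) (s : ReState) :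
    ∃ p : (ℝ → Fin 9 → ℝ) × ℝ, p.1 0 = s.1 ∧ (∀ σ, HasDerivAt p.1 (F gK ΛK (p.1 σ) + D.δF n σ) σ) ∧
      |p.2 - 19 / 20| ≤ 3 / 500 ∧ 0 < p.1 p.2 4 ∧ p.1 p.2 5 = (secCert.rho : ℝ) * p.1 p.2 4 ∧
      ((secCert.levLo : ℝ) ≤ p.1 p.2 5 / secCert.bmid ∧ p.1 p.2 5 / secCert.bmid ≤ secCert.levHi) ∧
      ∀ qm : Fin 4 → ℝ, (∀ m, |qm m - (Q1C m : ℝ)| ≤ Q1W m) →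
        ∀ b, |renorm (p.1 p.2) qm b - (reBox.cen b : ℝ)| ≤ reBox.rad b := by
  obtain ⟨⟨y, hy0, hsol⟩, hall⟩ := robust_induction_step_of D.hre (D.hδc n) (D.hδ n) s.1 s.2
  obtain ⟨τ, hτ, h4, hsec, hlev, hre'⟩ := hall y hy0 hsol
  exact ⟨(y, τ), hy0, hsol, hτ, h4, hsec, hlev, hre'⟩

/-- [folklore] -/
noncomputable def stepDataU (D : MachineDataU) (n : ℕ) (s : ReState) : (ℝ → Fin 9 → ℝ) × ℝ :=
  Classical.choose (step_specU D n s)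

/-- [folklore] -/
theorem stepDataU_spec (D : MachineDataU) (n : ℕ) (s : ReState) :
    (stepDataU D n s).1 0 = s.1 ∧
      (∀ σ, HasDerivAt (stepDataU D n s).1 (F gK ΛK ((stepDataU D n s).1 σ) + D.δF n σ) σ) ∧
      |(stepDataU D n s).2 - 19 / 20| ≤ 3 / 500 ∧ 0 < (stepDataU D n s).1 (stepDataU D n s).2 4 ∧
      (stepDataU D n s).1 (stepDataU D n s).2 5 =
        (secCert.rho : ℝ) * (stepDataU D n s).1 (stepDataU D n s).2 4 ∧
      ((secCert.levLo : ℝ) ≤ (stepDataU D n s).1 (stepDataU D n s).2 5 / secCert.bmid ∧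
        (stepDataU D n s).1 (stepDataU D n s).2 5 / secCert.bmid ≤ secCert.levHi) ∧
      ∀ qm : Fin 4 → ℝ, (∀ m, |qm m - (Q1C m : ℝ)| ≤ Q1W m) →
        ∀ b, |renorm ((stepDataU D n s).1 (stepDataU D n s).2) qm b - (reBox.cen b : ℝ)| ≤
          reBox.rad b :=
  Classical.choose_spec (step_specU D n s)

namespace MachineDataU

variable (D : MachineDataU)

/-- The renormalised trajectory of window start states under forcing. [folklore] -/
noncomputable def traj : ℕ → ReState
  | 0 => D.s₀
  | n + 1 => ⟨renorm ((stepDataU D n (traj n)).1 (stepDataU D n (traj n)).2) (D.qm n),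
      (stepDataU_spec D n (traj n)).2.2.2.2.2.2 (D.qm n) (D.hqm n)⟩

/-- [folklore] -/
noncomputable def ysol (n : ℕ) : ℝ → Fin 9 → ℝ := (stepDataU D n (D.traj n)).1

/-- [folklore] -/
noncomputable def τs (n : ℕ) : ℝ := (stepDataU D n (D.traj n)).2

/-- [folklore] -/
noncomputable def lev (n : ℕ) : ℝ := D.ysol n (D.τs n) 4 / X0 0

/-- [folklore] -/
noncomputable def amp : ℕ → ℝ
  | 0 => D.A₀
  | n + 1 => amp n * D.lev n

/-- [folklore] -/
noncomputable def dur (n : ℕ) : ℝ := D.τs n / (D.amp n * ΛK ^ n)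

/-- [folklore] -/
noncomputable def clock : ℕ → ℝ
  | 0 => 0
  | n + 1 => clock n + D.dur n

/-- The physical window `n`. [folklore] -/
noncomputable def win (n : ℕ) (t : ℝ) : Fin 9 → ℝ := D.amp n • D.ysol n (D.amp n * (ΛK ^ n * t))

/-- The physical forcing felt by window `n`. [folklore] -/
noncomputable def Φ (n : ℕ) (t : ℝ) : Fin 9 → ℝ :=
  (D.amp n ^ 2 * ΛK ^ n) • D.δF n (D.amp n * (ΛK ^ n * t))

/-- [folklore] -/
theorem traj_mem (n : ℕ) : ∀ b, |(D.traj n).1 b - (reBox.cen b : ℝ)| ≤ reBox.rad b := (D.traj n).2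

/-- [folklore] -/
theorem traj_succ (n : ℕ) : (D.traj (n + 1)).1 = renorm (D.ysol n (D.τs n)) (D.qm n) := rfl

/-- [folklore] -/
theorem ysol_start (n : ℕ) : D.ysol n 0 = (D.traj n).1 := (stepDataU_spec D n (D.traj n)).1

/-- Window `n` (unit scale) is a FORCED solution. [folklore] -/
theorem ysol_solves (n : ℕ) : ∀ σ, HasDerivAt (D.ysol n) (F gK ΛK (D.ysol n σ) + D.δF n σ) σ :=
  (stepDataU_spec D n (D.traj n)).2.1

/-- [folklore] -/
theorem τs_window (n : ℕ) : |D.τs n - 19 / 20| ≤ 3 / 500 := (stepDataU_spec D n (D.traj n)).2.2.1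

/-- [folklore] -/
theorem a₂_pos (n : ℕ) : 0 < D.ysol n (D.τs n) 4 := (stepDataU_spec D n (D.traj n)).2.2.2.1

/-- [folklore] -/
theorem on_section (n : ℕ) : D.ysol n (D.τs n) 5 = (secCert.rho : ℝ) * D.ysol n (D.τs n) 4 :=
  (stepDataU_spec D n (D.traj n)).2.2.2.2.1

/-- [folklore] -/
theorem level_eq (n : ℕ) : D.ysol n (D.τs n) 5 / secCert.bmid = D.lev n := by
  have h0 : ((X0Q 0 : ℚ) : ℝ) ≠ 0 := by exact_mod_cast X0Q_ne.1
  have h1 : ((X0Q 1 : ℚ) : ℝ) ≠ 0 := by exact_mod_cast X0Q_ne.2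
  have hr : (secCert.rho : ℝ) = (X0Q 1 : ℝ) / X0Q 0 := by
    show ((X0Q 1 / X0Q 0 : ℚ) : ℝ) = _; push_cast; rfl
  have hb : (secCert.bmid : ℝ) = (X0Q 1 : ℝ) := rfl
  rw [lev, D.on_section n, hr, hb, X0_eq]
  field_simp

/-- [folklore] -/
theorem lev_bounds (n : ℕ) : (9673 : ℝ) / 10000 ≤ D.lev n ∧ D.lev n ≤ 9718 / 10000 := by
  have h := (stepDataU_spec D n (D.traj n)).2.2.2.2.2.1
  rw [show (stepDataU D n (D.traj n)).1 = D.ysol n from rfl,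
    show (stepDataU D n (D.traj n)).2 = D.τs n from rfl, D.level_eq n] at h
  have hlo : ((secCert.levLo : ℚ) : ℝ) = 9673 / 10000 := by
    show (((9673 : ℚ) / 10000 : ℚ) : ℝ) = _; push_cast; rfl
  have hhi : ((secCert.levHi : ℚ) : ℝ) = 9718 / 10000 := by
    show (((9718 : ℚ) / 10000 : ℚ) : ℝ) = _; push_cast; rfl
  rw [hlo, hhi] at h
  exact h

/-- [folklore] -/
theorem lev_pos (n : ℕ) : 0 < D.lev n := by
  have := (D.lev_bounds n).1; linarith

/-- [folklore] -/
theorem amp_succ (n : ℕ) : D.amp (n + 1) = D.amp n * D.lev n := rfl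

/-- [folklore] -/
theorem amp_pos (n : ℕ) : 0 < D.amp n := by
  induction n with
  | zero => exact D.hA₀
  | succ n ih => rw [amp_succ]; exact mul_pos ih (D.lev_pos n)

/-- [folklore] -/
theorem amp_ge (n : ℕ) : D.A₀ * ((9673 : ℝ) / 10000) ^ n ≤ D.amp n := by
  induction n with
  | zero => simp [amp]
  | succ n ih =>
    rw [amp_succ, pow_succ, ← mul_assoc]
    exact mul_le_mul ih (D.lev_bounds n).1 (by positivity) (D.amp_pos n).le

/-- [folklore] -/
theorem growth (n : ℕ) : D.A₀ * 5 ^ n ≤ ΛK ^ n * D.amp n := by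
  have h1 : (5 : ℝ) ^ n ≤ (ΛK * (9673 / 10000)) ^ n :=
    pow_le_pow_left₀ (by norm_num) (by have := ΛK_ge; nlinarith) n
  calc D.A₀ * 5 ^ n ≤ D.A₀ * (ΛK * (9673 / 10000)) ^ n :=
        mul_le_mul_of_nonneg_left h1 D.hA₀.le
    _ = ΛK ^ n * (D.A₀ * (9673 / 10000) ^ n) := by rw [mul_pow]; ring
    _ ≤ ΛK ^ n * D.amp n := mul_le_mul_of_nonneg_left (D.amp_ge n) (pow_pos ΛK_pos n).le

/-- [folklore] -/
theorem durU_pos (n : ℕ) : (0 : ℝ) < MachineDataU.dur D n := by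
  have : 0 < D.τs n := by have := (abs_le.mp (D.τs_window n)).1; linarith
  exact div_pos this (mul_pos (D.amp_pos n) (pow_pos ΛK_pos n))

/-- [folklore] -/
theorem dur_le (n : ℕ) : D.dur n ≤ (239 : ℝ) / 250 / D.A₀ * (1 / 5) ^ n := by
  have hτ : D.τs n ≤ 239 / 250 := by have := (abs_le.mp (D.τs_window n)).2; linarith
  have hg := D.growth n
  have hA := D.hA₀
  have hden : 0 < D.amp n * ΛK ^ n := mul_pos (D.amp_pos n) (pow_pos ΛK_pos n)
  have h5 : (0 : ℝ) < 5 ^ n := pow_pos (by norm_num) n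
  have key : D.τs n / (D.amp n * ΛK ^ n) ≤ 239 / 250 / (D.A₀ * 5 ^ n) := by
    rw [div_le_div_iff₀ hden (mul_pos hA h5)]
    calc D.τs n * (D.A₀ * 5 ^ n) ≤ 239 / 250 * (ΛK ^ n * D.amp n) :=
          mul_le_mul hτ hg (by positivity) (by norm_num)
      _ = 239 / 250 * (D.amp n * ΛK ^ n) := by ring
  calc D.dur n = D.τs n / (D.amp n * ΛK ^ n) := rfl
    _ ≤ 239 / 250 / (D.A₀ * 5 ^ n) := key
    _ = 239 / 250 / D.A₀ * (1 / 5) ^ n := by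
        rw [one_div_pow, div_mul_div_comm, mul_one, div_div]

/-- [folklore] -/
theorem clock_succ (n : ℕ) : D.clock (n + 1) = D.clock n + D.dur n := rfl

/-- [folklore] -/
theorem clock_eq_sum (N : ℕ) : D.clock N = ∑ n ∈ range N, D.dur n := by
  induction N with
  | zero => simp [clock]
  | succ N ih => rw [clock_succ, sum_range_succ, ih]

/-- **Finite time** under forcing. [folklore] -/
theorem clock_le (N : ℕ) : D.clock N ≤ 6 / 5 / D.A₀ := by
  have hA := D.hA₀
  have hgeom : ∑ n ∈ range N, ((1 : ℝ) / 5) ^ n ≤ 5 / 4 := by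
    have h := geom_sum_Ico_le_of_lt_one (show (0 : ℝ) ≤ 1 / 5 by norm_num)
      (show (1 : ℝ) / 5 < 1 by norm_num) (m := 0) (n := N)
    simp only [pow_zero] at h
    rw [range_eq_Ico]
    linarith [show (1 : ℝ) / (1 - 1 / 5) = 5 / 4 by norm_num]
  calc D.clock N = ∑ n ∈ range N, D.dur n := D.clock_eq_sum N
    _ ≤ ∑ n ∈ range N, (239 : ℝ) / 250 / D.A₀ * (1 / 5) ^ n := sum_le_sum fun n _ => D.dur_le n
    _ = 239 / 250 / D.A₀ * ∑ n ∈ range N, ((1 : ℝ) / 5) ^ n := by rw [mul_sum]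
    _ ≤ 239 / 250 / D.A₀ * (5 / 4) := mul_le_mul_of_nonneg_left hgeom (by positivity)
    _ ≤ 6 / 5 / D.A₀ := by
        rw [div_mul_eq_mul_div, div_le_div_iff_of_pos_right hA]; norm_num

/-- **Window `n` solves the FORCED scale-`n` equations** `ẇ = ΛKⁿ•F(w) + Φₙ`. [folklore] -/
theorem win_solves (n : ℕ) : ∀ t, HasDerivAt (D.win n) (ΛK ^ n • F gK ΛK (D.win n t) + D.Φ n t) t :=
  forced_solution_scale (D.ysol_solves n) (D.amp n) (ΛK ^ n)

/-- The physical forcing is class U relative to the window's scale `(amp n)²·ΛKⁿ`. [folklore] -/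
theorem Φ_bound (n : ℕ) (t : ℝ) (a : Fin 9) : |D.Φ n t a| ≤ D.amp n ^ 2 * ΛK ^ n * (δUQ a : ℝ) := by
  have hs : 0 ≤ D.amp n ^ 2 * ΛK ^ n := by have := pow_pos ΛK_pos n; positivity
  simp only [Φ, Pi.smul_apply, smul_eq_mul, abs_mul, abs_of_nonneg hs]
  exact mul_le_mul_of_nonneg_left (D.hδ n _ a) hs

/-- [folklore] -/
theorem win_start (n : ℕ) : D.win n 0 = D.amp n • (D.traj n).1 := by
  simp [win, D.ysol_start n]

/-- [folklore] -/
theorem win_end (n : ℕ) : D.win n (D.dur n) = D.amp n • D.ysol n (D.τs n) := by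
  have hA : D.amp n ≠ 0 := (D.amp_pos n).ne'
  have hΛ : ΛK ^ n ≠ 0 := (pow_pos ΛK_pos n).ne'
  have ht : D.amp n * (ΛK ^ n * (D.τs n / (D.amp n * ΛK ^ n))) = D.τs n := by field_simp
  simp only [win, dur, ht]

/-- **Hand-over consistency, old gate** (forced case). [folklore] -/
theorem handover (n : ℕ) :
    D.win (n + 1) 0 0 = D.win n (D.dur n) 4 ∧ D.win (n + 1) 0 1 = D.win n (D.dur n) 5 ∧
    D.win (n + 1) 0 2 = D.win n (D.dur n) 6 ∧ D.win (n + 1) 0 3 = D.win n (D.dur n) 7 ∧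
    D.win (n + 1) 0 4 = D.win n (D.dur n) 8 := by
  have h4 : D.ysol n (D.τs n) 4 ≠ 0 := (D.a₂_pos n).ne'
  have hX : X0 0 ≠ 0 := X0_zero_pos.ne'
  have h0 : ((X0Q 0 : ℚ) : ℝ) ≠ 0 := by exact_mod_cast X0Q_ne.1
  have hsec := D.on_section n
  have hr : (secCert.rho : ℝ) = (X0Q 1 : ℝ) / X0Q 0 := by
    show ((X0Q 1 / X0Q 0 : ℚ) : ℝ) = _; push_cast; rfl
  rw [D.win_end n, D.win_start (n + 1), D.traj_succ n, D.amp_succ n]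
  simp only [Pi.smul_apply, smul_eq_mul, renorm, lev, Matrix.cons_val_zero, Matrix.cons_val_one]
  refine ⟨?_, ?_, ?_, ?_, ?_⟩
  · field_simp
  · rw [hsec, hr, X0_eq, X0_eq]; field_simp
  · show D.amp n * (D.ysol n (D.τs n) 4 / X0 0) *
        (![X0 0, X0 1, X0 0 * D.ysol n (D.τs n) 6 / D.ysol n (D.τs n) 4,
          X0 0 * D.ysol n (D.τs n) 7 / D.ysol n (D.τs n) 4,
          X0 0 * D.ysol n (D.τs n) 8 / D.ysol n (D.τs n) 4, D.qm n 0, D.qm n 1, D.qm n 2,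
          D.qm n 3] : Fin 9 → ℝ) 2 = D.amp n * D.ysol n (D.τs n) 6
    simp; field_simp
  · show D.amp n * (D.ysol n (D.τs n) 4 / X0 0) *
        (![X0 0, X0 1, X0 0 * D.ysol n (D.τs n) 6 / D.ysol n (D.τs n) 4,
          X0 0 * D.ysol n (D.τs n) 7 / D.ysol n (D.τs n) 4,
          X0 0 * D.ysol n (D.τs n) 8 / D.ysol n (D.τs n) 4, D.qm n 0, D.qm n 1, D.qm n 2,
          D.qm n 3] : Fin 9 → ℝ) 3 = D.amp n * D.ysol n (D.τs n) 7
    simp; field_simp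
  · show D.amp n * (D.ysol n (D.τs n) 4 / X0 0) *
        (![X0 0, X0 1, X0 0 * D.ysol n (D.τs n) 6 / D.ysol n (D.τs n) 4,
          X0 0 * D.ysol n (D.τs n) 7 / D.ysol n (D.τs n) 4,
          X0 0 * D.ysol n (D.τs n) 8 / D.ysol n (D.τs n) 4, D.qm n 0, D.qm n 1, D.qm n 2,
          D.qm n 3] : Fin 9 → ℝ) 4 = D.amp n * D.ysol n (D.τs n) 8
    simp; field_simp

/-- **Hand-over consistency, fresh gate** (forced case). [folklore] -/
theorem handover_fresh (n : ℕ) (m : Fin 4) :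
    D.win (n + 1) 0 ⟨5 + m, by omega⟩ = D.amp (n + 1) * D.qm n m := by
  rw [D.win_start (n + 1), D.traj_succ n]
  simp only [Pi.smul_apply, smul_eq_mul, renorm]
  fin_cases m <;> rfl

/-- **THE FORCED TOY MACHINE** (summary). [folklore] -/
theorem machine (D : MachineDataU) :
    (∀ n, ∀ b, |(D.traj n).1 b - (reBox.cen b : ℝ)| ≤ reBox.rad b) ∧
    (∀ n t, HasDerivAt (D.win n) (ΛK ^ n • F gK ΛK (D.win n t) + D.Φ n t) t) ∧
    (∀ n t a, |D.Φ n t a| ≤ D.amp n ^ 2 * ΛK ^ n * (δUQ a : ℝ)) ∧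
    (∀ n, D.win n 0 = D.amp n • (D.traj n).1) ∧
    (∀ n, D.win (n + 1) 0 0 = D.win n (D.dur n) 4 ∧ D.win (n + 1) 0 1 = D.win n (D.dur n) 5 ∧
      D.win (n + 1) 0 2 = D.win n (D.dur n) 6 ∧ D.win (n + 1) 0 3 = D.win n (D.dur n) 7 ∧
      D.win (n + 1) 0 4 = D.win n (D.dur n) 8) ∧
    (∀ n, 0 < D.dur n) ∧ (∀ N, D.clock N ≤ 6 / 5 / D.A₀) ∧ (∀ n, D.A₀ * 5 ^ n ≤ ΛK ^ n * D.amp n) :=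
  ⟨D.traj_mem, D.win_solves, D.Φ_bound, D.win_start, D.handover, D.durU_pos, D.clock_le, D.growth⟩

end MachineDataU

end RowChain

end Summit.NavierStokesRegularity.FluidComputer
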